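import Literature.NumberTheory.Sieve.SmoothZetaComplex
import Literature.NumberTheory.Sieve.SmoothSaddlePoint
import HarnessLib

/-!
# Long-range decay of `ζ(α + it, y)/ζ(α, y)` in the polylog regime (statement)

Topic `Literature/NumberTheory/Sieve`; a DEFINITIONS file.  Hildebrand–Tenenbaum, Trans. AMS 296 (1986), Lemma 8 (ii)
[HildebrandTenenbaum1986, (3.16)]: for fixed `ε > 0`, uniformly for `y ≥ y₀(ε)`, `1/log y < |t| ≤ Y(ε) = exp((log y)^{3/2−ε})`,
`|ζ(s, y)/ζ(α, y)| ≪_ε exp(−c₆ u t²/((1−α)² + t²))` (`s = α(x,y) + it`, `u = log x/log y`).  The tree proves the decay only for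
`|t| ≤ κ √y` (`SmoothTwistedSaddleRange.twist_range`, from Chebyshev / Brun–Titchmarsh); the statement below is the special case
`3 ≤ |t| ≤ y¹²` of Lemma 8 (ii) in the polylog regime `(log x)^4 ≤ y ≤ exp((log x)^{1/5})`, where `t²/((1−α)²+t²) ≥ 1/2`, with the
rate `exp(−c u)`.  Unconditionally it follows from the Vinogradov–Korobov zero-free region (op. cit. Lemma 6); under the Riemann
Hypothesis for `ζ` it follows from the twisted prime number theorem with square-root error (proved in a companion file from the
tree's GRH chain).  It is the input that extends the saddle-point evaluation of the twisted friable sums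
(`TwistedWeight.scaledSum_main_term_quant`) from `|λ| ≤ y^{1/8}` to `|λ| ≤ y⁷`.

## References

* A. Hildebrand, G. Tenenbaum, Trans. AMS 296 (1986) 265–290, Lemma 8 (ii) (3.16), p. 275 [HildebrandTenenbaum1986].
-/

noncomputable section

open Complex

namespace Literature.NumberTheory.Sieve

/-- **Long-range decay of the friable zeta ratio** [HildebrandTenenbaum1986, Lemma 8 (ii), (3.16), the range `3 ≤ |t| ≤ y¹²`
in the polylog regime]: there are `c > 0` and `x₀` such that for `x ≥ x₀`, `(log x)^4 ≤ y ≤ exp((log x)^{1/5})`, `α = α(x, y)`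
and `3 ≤ |t| ≤ y¹²`, `|ζ(α + it, y)|/ζ(α, y) ≤ exp(−c · log x/log y)`. [cite: HildebrandTenenbaum1986, Lemma 8 (ii) (3.16)] -/
def FriableZetaLongRangeDecay : Prop :=
  ∃ c : ℝ, 0 < c ∧ ∃ x₀ : ℝ, ∀ (x : ℝ) (y : ℕ), x₀ ≤ x → Real.log x ^ 4 ≤ (y : ℝ) →
    Real.log (y : ℝ) ≤ Real.log x ^ (1 / 5 : ℝ) → ∀ t : ℝ, 3 ≤ |t| → |t| ≤ (y : ℝ) ^ 12 →
      ‖smoothZetaC ((saddlePoint x y : ℂ) + t * I) y‖ / smoothZeta (saddlePoint x y) y ≤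
        Real.exp (-(c * (Real.log x / Real.log (y : ℝ))))

end Literature.NumberTheory.Sieve

end
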